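import Literature.Probability.Percolation.TriUQuadFence
import HarnessLib

/-!
# Fence routes piece by piece: the two kinds of frame crossings

Topic `Literature/Probability/Percolation`; family `crit-perc`, statement **crit-perc.S16**
(`Literature.Probability.Percolation.triTheta_exponent`). A refinement of the route invariant of
`TriUQuadFence.lean` (`uFence_core`) for the fence step of Kesten's arm separation in the
U-shaped half-plane region (P. Nolin, EJP 13 (2008), §4.2 Def. 6, §4.4 proof of Lemma 15
[arXiv 0711.4948: Def. 6, Lemma 14]), needed for tips near the corners of the inner arc, where the
four crossings of the frame about the tip must be traversed one at a time, in a prescribed order.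

Setting: quad `uQuad k N`, a crossing support `S ∋ l` meeting the inner arc only at its tip `l`
(the canonical lowest crossing), the low sites `uLow k N S` (joined to `uB` off `S`), an examined
set `P₀ ⊆ uLow ∪ S` inside `U` (the stopping set `openStop`), and the forced configuration
`ξ = ω ∪ (P₀ ∪ (U ∪ I)ᶜ)`. A site is **high** if it is in `U`, off `S` and not low; high sites and
sites of `I` that are open in `ξ` are open in `ω`. For a set `P` of `ξ`-open sites (one crossing
of the frame, or a sub-path of it):

* `uPiece_high` — **kind B** (the piece may cross the arc before the tip): a `𝕋`-path inside `P`
  from a high site either stays high all along (and is `ω`-open), or reaches a site of `S` through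
  high sites; provided no site of `P ∩ I` is adjacent to an arc site beyond the tip, and sites of
  `P` adjacent to sites off `U ∪ I` are low or in `S` or off `U`.
* `uPiece_beyond` — **kind A** (every arc site of `P` lies beyond the tip): the same from any site
  of `(P ∩ I) ∪ high`, the invariant being `(P ∩ I) ∪ high`; provided sites of `P ∩ I` have all
  their `P`-neighbours in `U ∪ I`, and the same fake-site condition.

Both are `PathIn.exit_or` + `PathIn.inter_of_invariant` with the no-low–high-adjacency and the
cut property of the tip (`not_joined_uB_of_gt`, `exists_pathIn_arc_lt`).

## References

* P. Nolin, Near-critical percolation in two dimensions, *Electron. J. Probab.* 13 (2008), §4.2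
  Def. 6, §4.4 proof of Lemma 15 [arXiv 0711.4948: Def. 6, Lemma 14] [Nolin2008].
* H. Kesten, Scaling relations for 2D-percolation, *Comm. Math. Phys.* 109 (1987), Lemma 2
  [KestenScalingCMP1987].

## Mathlib / tree

Tree: `uLow`, `uLow_step` (`TriUQuadFence.lean`), `uHt`, `arcPt_uHt`, `exists_pathIn_arc_lt`,
`not_joined_uB_of_gt` (`TriUQuadArc.lean`), `PathIn.exit_or` (`SitePaths.lean`),
`PathIn.inter_of_invariant` (`ArmSeparationFrame.lean`), `uL`, `uSites`, `uInner`,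
`mem_coe_uSites`.
-/

noncomputable section

open Set

namespace Literature.Probability.Percolation

open LatticeModels

variable {k N : ℕ}

/-- **The high sites** relative to a crossing `S` of `U_{k,N}`: in `U`, off `S`, not low. [cite: Nolin2008, §4.4, proof of Lemma 15 (arXiv 0711.4948: Lemma 14)] -/
def uHigh (k N : ℕ) (S : Set (Site 2)) : Set (Site 2) :=
  {v | v ∈ (↑(uSites k N) : Set (Site 2)) ∧ v ∉ uLow k N S ∧ v ∉ S}

section Pieces

variable {S : Set (Site 2)} {l y : Site 2} {ω P₀ P : Set (Site 2)}

/-- High sites of a `ξ`-open set off the examined set are `ω`-open, and so are its sites inside the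
inner box (`ξ = ω ∪ (P₀ ∪ (U ∪ I)ᶜ)`, `P₀ ⊆ uLow ∪ S`). [folklore] -/
theorem open_of_uHigh_or_inner (hSU : S ⊆ ↑(uSites k N)) (hP₀ : P₀ ⊆ uLow k N S ∪ S)
    (hPξ : P ⊆ ω ∪ (P₀ ∪ ((↑(uSites k N) : Set (Site 2)) ∪ uInner k)ᶜ)) {v : Site 2} (hvP : v ∈ P)
    (hv : v ∈ uHigh k N S ∨ v ∈ uInner k) : v ∈ ω := by
  rcases hPξ hvP with h | h | h
  · exact h
  · rcases hv with ⟨-, hvL, hvS⟩ | hvI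
    · rcases hP₀ h with h' | h'
      · exact absurd h' hvL
      · exact absurd h' hvS
    · rcases hP₀ h with h' | h'
      · exact absurd hvI (mem_coe_uSites.1 (uLow_subset h').1).2
      · exact absurd hvI (mem_coe_uSites.1 (hSU h')).2
  · rcases hv with ⟨hvU, -, -⟩ | hvI
    · exact absurd (Or.inl hvU) h
    · exact absurd (Or.inr hvI) h

/-- High arc sites lie beyond the tip (cut property of the tip). [cite: Nolin2008, §4.4, proof of Lemma 15 (arXiv 0711.4948: Lemma 14)] -/
theorem uHt_lt_of_uHigh (hk : 1 ≤ k) (hkN : k + 1 ≤ N) (honly : ∀ z ∈ S, z ∈ uL k N → z = l) (hl : l ∈ uL k N) (hlS : l ∈ S)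
    {a : Site 2} (haL : a ∈ uL k N) (ha : a ∈ uHigh k N S) : uHt k l < uHt k a := by
  obtain ⟨-, haLow, haS⟩ := ha
  by_contra hle
  push Not at hle
  rcases hle.lt_or_eq with hlt | heq
  · exact haLow (exists_pathIn_arc_lt hk hkN honly haL hlt)
  · have h1 := (arcPt_uHt hk hkN haL).1
    have h2 := (arcPt_uHt hk hkN hl).1
    rw [heq, h2] at h1
    exact haS (h1 ▸ hlS)

/-- **Kind B pieces (may cross the arc before the tip).** Let `P` be `ξ`-open, with no site of
`P ∩ I` adjacent to an arc site beyond the tip, and such that a site of `P` adjacent to a site of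
`P` off `U ∪ I` is off `U` or low or in `S`. Then a `𝕋`-path inside `P` from a high site either
runs through high sites to its end, or runs through high sites to a neighbour of a site of
`S ∩ P`; high sites of `P` are `ω`-open. [cite: Nolin2008, §4.4, proof of Lemma 15 (arXiv 0711.4948: Lemma 14)] -/
theorem uPiece_high (hk : 1 ≤ k) (hkN : k + 1 ≤ N) (honly : ∀ z ∈ S, z ∈ uL k N → z = l)
    (hl : l ∈ uL k N) (hlS : l ∈ S)
    (hBI : ∀ a ∈ uL k N, uHt k l < uHt k a → ∀ b ∈ P, b ∈ uInner k → ¬ triGraph.Adj a b)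
    (hfake : ∀ a ∈ P, ∀ b ∈ P, triGraph.Adj a b → b ∉ (↑(uSites k N) : Set (Site 2)) → b ∉ uInner k →
      a ∈ (↑(uSites k N) : Set (Site 2)) → a ∈ uLow k N S ∨ a ∈ S)
    {a t : Site 2} (ha : a ∈ uHigh k N S) (hp : PathIn triGraph P a t) :
    PathIn triGraph (P ∩ uHigh k N S) a t ∨
      ∃ a' g, g ∈ S ∧ g ∈ P ∧ triGraph.Adj a' g ∧ PathIn triGraph (P ∩ uHigh k N S) a a' := by
  have hstep : ∀ x z, x ∈ Sᶜ ∩ P → x ∈ uHigh k N S → z ∈ Sᶜ ∩ P → triGraph.Adj x z → z ∈ uHigh k N S := by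
    rintro x z ⟨-, hxP⟩ hx ⟨hzS, hzP⟩ hxz
    obtain ⟨hxU, hxLow, hxS⟩ := hx
    by_cases hzU : z ∈ (↑(uSites k N) : Set (Site 2))
    · exact ⟨hzU, fun hzLow => hxLow (uLow_step hzLow hxU hxS hxz.symm), hzS⟩
    · by_cases hzI : z ∈ uInner k
      · -- `x` is then an arc site, high, hence beyond the tip: excluded
        have hxL : x ∈ uL k N := ⟨hxU, z, hzI, hxz.symm⟩
        exact absurd hxz (hBI x hxL (uHt_lt_of_uHigh hk hkN honly hl hlS hxL ⟨hxU, hxLow, hxS⟩) z hzP hzI)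
      · rcases hfake x hxP z hzP hxz hzU hzI hxU with h | h
        · exact absurd h hxLow
        · exact absurd h hxS
  rcases hp.exit_or (R := Sᶜ) ha.2.2 with hin | ⟨a', g, -, hgS, hgP, hag, hpre⟩
  · left
    have := hin.inter_of_invariant (G := uHigh k N S) ha hstep
    exact this.mono fun z hz => ⟨hz.1.2, hz.2⟩
  · right
    simp only [mem_compl_iff, not_not] at hgS
    have := hpre.inter_of_invariant (G := uHigh k N S) ha hstep
    exact ⟨a', g, hgS, hgP, hag, this.mono fun z hz => ⟨hz.1.2, hz.2⟩⟩

/-- **Kind A pieces (all arc sites beyond the tip).** Let `P` be `ξ`-open, with every arc site of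
`P` beyond the tip, every `P`-neighbour of a site of `P ∩ I` inside `U ∪ I`, and the fake-site
condition of `uPiece_high`. Then a `𝕋`-path inside `P` from a site of `(P ∩ I) ∪ high` either runs
inside `(P ∩ I) ∪ high` to its end, or inside it to a neighbour of a site of `S ∩ P`; all these
sites are `ω`-open. [cite: Nolin2008, §4.4, proof of Lemma 15 (arXiv 0711.4948: Lemma 14)] -/
theorem uPiece_beyond (hk : 1 ≤ k) (hkN : k + 1 ≤ N) (hSU : S ⊆ ↑(uSites k N))
    (honly : ∀ z ∈ S, z ∈ uL k N → z = l) (hl : l ∈ uL k N) (hy : y ∈ uR k N) (hpγ : PathIn triGraph S l y)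
    (hParc : ∀ b ∈ P, b ∈ uL k N → uHt k l < uHt k b)
    (hPI : ∀ a ∈ P, a ∈ uInner k → ∀ b ∈ P, triGraph.Adj a b → b ∈ (↑(uSites k N) : Set (Site 2)) ∨ b ∈ uInner k)
    (hfake : ∀ a ∈ P, ∀ b ∈ P, triGraph.Adj a b → b ∉ (↑(uSites k N) : Set (Site 2)) → b ∉ uInner k →
      a ∈ (↑(uSites k N) : Set (Site 2)) → a ∈ uLow k N S ∨ a ∈ S)
    {a t : Site 2} (ha : a ∈ (P ∩ uInner k) ∪ uHigh k N S) (hp : PathIn triGraph P a t) :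
    PathIn triGraph (P ∩ ((P ∩ uInner k) ∪ uHigh k N S)) a t ∨
      ∃ a' g, g ∈ S ∧ g ∈ P ∧ triGraph.Adj a' g ∧ PathIn triGraph (P ∩ ((P ∩ uInner k) ∪ uHigh k N S)) a a' := by
  have hlS : l ∈ S := hpγ.left_mem
  have hUI : ∀ v, v ∈ (↑(uSites k N) : Set (Site 2)) → v ∈ uInner k → False :=
    fun v hvU hvI => (mem_coe_uSites.1 hvU).2 hvI
  set Inv : Set (Site 2) := (P ∩ uInner k) ∪ uHigh k N S with hInv
  have hstep : ∀ x z, x ∈ Sᶜ ∩ P → x ∈ Inv → z ∈ Sᶜ ∩ P → triGraph.Adj x z → z ∈ Inv := by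
    rintro x z ⟨-, hxP⟩ hx ⟨hzS, hzP⟩ hxz
    rcases hx with ⟨-, hxI⟩ | ⟨hxU, hxLow, hxS⟩
    · rcases hPI x hxP hxI z hzP hxz with hzU | hzI
      · -- an arc site of `P`: beyond the tip, hence high
        right
        have hzL : z ∈ uL k N := ⟨hzU, x, hxI, hxz⟩
        exact ⟨hzU, not_joined_uB_of_gt hk hkN hSU hl hy hpγ honly hzL (hParc z hzP hzL), hzS⟩
      · exact Or.inl ⟨hzP, hzI⟩
    · by_cases hzU : z ∈ (↑(uSites k N) : Set (Site 2))
      · exact Or.inr ⟨hzU, fun hzLow => hxLow (uLow_step hzLow hxU hxS hxz.symm), hzS⟩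
      · by_cases hzI : z ∈ uInner k
        · exact Or.inl ⟨hzP, hzI⟩
        · rcases hfake x hxP z hzP hxz hzU hzI hxU with h | h
          · exact absurd h hxLow
          · exact absurd h hxS
  have haS : a ∈ Sᶜ := by
    rcases ha with ⟨-, haI⟩ | ⟨-, -, haS⟩
    · exact fun h => hUI a (hSU h) haI
    · exact haS
  rcases hp.exit_or (R := Sᶜ) haS with hin | ⟨a', g, -, hgS, hgP, hag, hpre⟩
  · left
    have := hin.inter_of_invariant (G := Inv) ha hstep
    exact this.mono fun z hz => ⟨hz.1.2, hz.2⟩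
  · right
    simp only [mem_compl_iff, not_not] at hgS
    have := hpre.inter_of_invariant (G := Inv) ha hstep
    exact ⟨a', g, hgS, hgP, hag, this.mono fun z hz => ⟨hz.1.2, hz.2⟩⟩

/-- The sites visited by a kind-A route are `ω`-open and lie in `U ∪ I`. [folklore] -/
theorem pieceA_subset_open (hSU : S ⊆ ↑(uSites k N)) (hP₀ : P₀ ⊆ uLow k N S ∪ S)
    (hPξ : P ⊆ ω ∪ (P₀ ∪ ((↑(uSites k N) : Set (Site 2)) ∪ uInner k)ᶜ)) :
    P ∩ ((P ∩ uInner k) ∪ uHigh k N S) ⊆ ω ∩ ((↑(uSites k N) : Set (Site 2)) ∪ uInner k) := by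
  rintro v ⟨hvP, hv⟩
  rcases hv with ⟨-, hvI⟩ | hvH
  · exact ⟨open_of_uHigh_or_inner hSU hP₀ hPξ hvP (Or.inr hvI), Or.inr hvI⟩
  · exact ⟨open_of_uHigh_or_inner hSU hP₀ hPξ hvP (Or.inl hvH), Or.inl hvH.1⟩

/-- The sites visited by a kind-B route are `ω`-open and lie in `U`. [folklore] -/
theorem pieceB_subset_open (hSU : S ⊆ ↑(uSites k N)) (hP₀ : P₀ ⊆ uLow k N S ∪ S)
    (hPξ : P ⊆ ω ∪ (P₀ ∪ ((↑(uSites k N) : Set (Site 2)) ∪ uInner k)ᶜ)) :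
    P ∩ uHigh k N S ⊆ ω ∩ ((↑(uSites k N) : Set (Site 2)) ∪ uInner k) := by
  rintro v ⟨hvP, hvH⟩
  exact ⟨open_of_uHigh_or_inner hSU hP₀ hPξ hvP (Or.inl hvH), Or.inl hvH.1⟩

end Pieces

end Literature.Probability.Percolation
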